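import Literature.Analysis.FluidPDE.Ferrari1993Continuation
import Mathlib.Analysis.SpecialFunctions.Log.PosLog
import Mathlib.Topology.Algebra.Order.Floor
import HarnessLib

/-!
# The a-priori `H³` bound `Ferrari1993_periodicCylinderH3Bound` from the `H^s` energy
inequality and the logarithmic `W^{1,∞}` estimate

Topic `Literature/Analysis/FluidPDE`. Decomposition file for the named fact
`Literature.Analysis.FluidPDE.Ferrari1993_periodicCylinderH3Bound` (`Ferrari1993Continuation.lean`):
a solution `(u, p)` of the smooth periodic class `IsPeriodicCylinderEulerSolution L [0, T) u₀` in
the periodic cylinder `{r < 1} × ℝ/Lℤ` whose vorticity is bounded on `[0, T) × {r < 1}` has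
`H³ = W^{3,2}` norms on the period cell bounded uniformly in `t ∈ [0, T)`. This is Ferrari's
implication (4) ⇒ (7) = (17) (A. B. Ferrari, Comm. Math. Phys. **155** (1993), proof of Thm 2,
pp. 279–282 of the held text), whose printed proof has exactly two analytic inputs and one
elementary step:

1. the **`H^s` energy inequality** (13)/(14), p. 281: `|u(t)|_s ≤ |u₀|_s exp(C ∫₀ᵗ |u(τ)|_{W^{1,∞}} dτ)`
   (from the `D^α`-energy identity (8), the calculus inequalities of Lemma 1 and the pressure
   estimate of Lemma 2, `|∇p|_{H^s} ≤ C |u|_{W^{1,∞}} |u|_{H^s}`, a Neumann problem up to the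
   boundary; the same inequality is (14), p. 80, of Shirota–Yanagisawa 1993) — vendored here as
   the named fact `Ferrari1993_periodicCylinderHsEnergyInequality`;
2. the **logarithmic estimate** (6) = (31), Cor. 1 of Prop. 1, p. 286:
   `|u(t)|_{W^{1,∞}} ≤ C[(1 + log⁺ |u(t)|_{H³}) |ω(t)|_{L^∞} + 1]` for `Ω` simply connected; for
   bounded domains of general topology Shirota–Yanagisawa 1993, (15)–(17), p. 80:
   `|∇u(t)|_{L^∞} ≤ C{‖u(0)‖_{L²} + 1 + (1 + log⁺ ‖u(t)‖_s) ‖rot u(t)‖_{L^∞}}`, the harmonic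
   components being controlled by the conserved energy `‖u(t)‖₀ ≤ ‖u(0)‖₀` ((17) there) —
   vendored here, in the general-topology form (the periodic cylinder is not simply connected:
   `e_z` is a harmonic field, and Ferrari's form with `+ 1` alone fails for `u = c e_z`,
   `ω = 0`), as the named fact `ShirotaYanagisawa1993_periodicCylinderLogEstimate`;
3. the **Gronwall argument** (15)–(17), pp. 281–282 (Beale–Kato–Majda 1984 in the whole space):
   with `U = |u|_{H^s} + e`, `log U(t) ≤ log U(0) + C ∫₀ᵗ (1 + |ω|_{L^∞} log U)`, whence
   `|u(t)|_{H^s} ≤ K` on `[0, T]` with `K` depending on `|u₀|_{H^s}`, `T` and `sup |ω|`.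

This file **proves** 3:
`Ferrari1993_periodicCylinderH3Bound_of_estimates : 1 → 2 → (X) → target`, where (X) is the
time-local boundedness of the `H³` norms of the smooth class
(`smoothPeriodicCylinderClass_locallyBoundedH3Norm`: `sup_{[0,b]} ‖u(t)‖_{H³(cell)} < ∞` for
`b < T`, i.e. the smooth class lies in Ferrari's `C([0,T']; H^s(Ω))` / Shirota–Yanagisawa's
`X_s(T')` for `T' < T` as far as boundedness goes — folklore for fields `C^∞` up to the
boundary jointly in `(t, x)`, recorded as a separate proposition because the tree's Sobolev norm
`eSobolevDomainNorm` is defined through weak derivatives; its discharge is calculus, not PDE,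
and is done in `Ferrari1993H3BoundRegularity.lean`, which records the target on facts 1 and 2
alone, `Ferrari1993_periodicCylinderH3Bound_of_energyInequality_of_logEstimate`). Ferrari's
approximation argument of pp. 282–283 (data a priori only in `C([0,T̂); H^s)`) is not needed: in
the smooth class every slice is `H^{s+1}`.

## The Gronwall step without measurability

The named facts are stated robustly (no junk values): 1 is guarded by a bound `B` on the
*lower* Lebesgue integral `∫⁻_{(0,t)} ‖u(τ)‖_{W^{1,∞}(cell)} dτ` of the `ℝ≥0∞`-valued norm, and 2
by real upper bounds `n, e₀, A` of the three norms involved (all printed right-hand sides are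
monotone in them). Accordingly the Gronwall step is run on the real function
`f(t) = log(‖u(t)‖_{H³(cell)} + 1)` without any measurability or continuity in `t`, by Picard
iteration (`gronwall_picard`): if `f ≤ m` on `[0, b]` and every continuous majorant `g ≥ f`
on `[0, b]` yields `f(t) ≤ α + βt + γ ∫₀ᵗ g`, then `f(t) ≤ (α + βb) e^{γt}` (iterate on the
majorants `(α + βb)e^{γt} + m (γt)^k / k!` and let `k → ∞`). Time-local boundedness (X) supplies
`m`; pointwise finiteness alone would not do (the feedback inequality from base point `0` is
compatible with a norm that is bounded on `[0, σ]` and behaves like `1/(t − σ)` after `σ`).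

## Faithfulness / what is NOT here

* Facts 1 and 2 are rendered in the periodic class `IsPeriodicCylinderEulerSolution` of
  `KatoLaiPeriodicCylinder.lean` (the target's class), on the open period cell `cylinderCell L`
  with the tree's Sobolev norms `eSobolevDomainNorm k p (cylinderCell L) volume` (sum form, via
  weak derivatives; `H³ = W^{3,2}`, `W^{1,∞}`, `L² = W^{0,2}`), equivalent to the printed norms
  up to constants absorbed in `C`. They inherit the target's adaptation caveat: the printed
  theorems concern bounded domains of `ℝ³` with smooth boundary (simply connected in Ferrari,
  of general topology in Shirota–Yanagisawa), while `{r ≤ 1} × ℝ/Lℤ` is a compact flat manifold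
  with boundary; this is the use made of them by Luo–Hou 2014, §4.4 p. 1744, and Chen–Hou 2021 §9.
  `0 < L` is kept as in the sibling facts.
* Fact 2 is stated, as printed by Shirota–Yanagisawa ((15) with (17)), for *solutions* and with
  the energy `‖u₀‖_{L²}` of the datum on the right (the `L²` conservation is part of its printed
  proof); Ferrari's Prop. 1 (the estimate for the elliptic system (21)) is not vendored separately.
* Not here: the discharge of 1 (Moser calculus inequalities and elliptic Neumann regularity on
  the cell), of 2 (Agmon–Douglis–Nirenberg systems, Solonnikov's Green matrices / harmonic
  integrals); (X) is discharged in `Ferrari1993H3BoundRegularity.lean` (the classical derivatives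
  of a slice are weak derivatives on the cell and are bounded on `[0, b] × closure (cell)`).

Mathlib/tree search: Mathlib's Gronwall lemmas (`Mathlib.Analysis.ODE.Gronwall`,
`le_gronwallBound_of_liminf_deriv_right_le`) need `ContinuousOn f (Icc a b)`; the tree has two
integral-form Gronwall lemmas, `SerrinEnstrophyGronwall.lintegral_gronwall_le` (in `ℝ≥0∞`, lower
integrals of a bounded, possibly non-measurable `φ` — the nearest existing lemma) and
`FunctionSpaces.gronwall_of_le_integral` (measurable real `φ`); `gronwall_picard` below has a
different shape (the feedback runs through continuous majorants of a possibly non-measurable `f`,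
which is how the lintegral-guarded fact 1 is consumed), so it is kept; `Real.posLog` (`log⁺`) is
Mathlib's; used from Mathlib:
`FloorSemiring.tendsto_pow_div_factorial_atTop`, `intervalIntegral.integral_eq_sub_of_hasDerivAt`,
`integral_pow`, `MeasureTheory.ofReal_integral_eq_lintegral_ofReal`, `setLIntegral_mono'`,
`intervalIntegral.integral_of_le`, `integral_Ioc_eq_integral_Ioo`.
-/

noncomputable section

open MeasureTheory Set Function Filter Topology TopologicalSpace WithLp
open scoped ContDiff NNReal ENNReal InnerProductSpace RealInnerProductSpace Nat

namespace Literature.Analysis.FluidPDE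

/-- Local notation for physical space `ℝ³ = EuclideanSpace ℝ (Fin 3)`. -/
local notation "ℝ³" => EuclideanSpace ℝ (Fin 3)

/-! ### The two named facts and the time-regularity proposition -/

/-- **The `H^s` energy inequality** (Ferrari 1993, (13)–(14), p. 281: for a solution of (1)–(3)
in `C([0,T]; H^{s+1}(Ω))`, `Ω ⊂ ℝ³` bounded with smooth boundary, `s ≥ 3`,
`½ d/dt |u(t)|²_s ≤ C |u|²_s |u|_{W^{1,∞}}` (13), "so that by Gronwall's inequality"
`|u(·,t)|_s ≤ |u₀|_s exp(C ∫₀ᵗ |u(·,τ)|_{W^{1,∞}} dτ)` (14), `C` depending on `Ω` and `s`; from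
the `D^α`-energy identity (8), Lemma 1 (calculus inequalities) and Lemma 2
(`|∇p|_{H^s} ≤ C |u|_{W^{1,∞}} |u|_{H^s}`, pp. 280–281); the same inequality for general
topology: Shirota–Yanagisawa 1993, (14) p. 80). **Rendering** (`s = 3` only — the `Hs` of
the name refers to the printed (13)–(14), the statement is the `H³` case serving
`Ferrari1993_periodicCylinderH3Bound`; periodic class `IsPeriodicCylinderEulerSolution`; norms on
the open period cell by the tree's `eSobolevDomainNorm`, i.e. the sum form
`Σ_{|w| ≤ 3} ‖∂_w u‖_{L²(cell)}` over ordered multi-indices: the `D^α`-energy argument (8)–(13)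
bounds the growth rate of every summand by `C ‖u‖_{H³} ‖u‖_{W^{1,∞}}`, so (14) holds for this
norm with prefactor `1` in front of `‖u₀‖` and the norm equivalence constants inside `C`): for
`L > 0` there is `C` such that for every solution `(u, p)` of the class on `[0, T)`
with datum `u₀`, every `t ∈ [0, T)` and every bound `B` of the (lower Lebesgue) time integral
`∫⁻_{(0,t)} ‖u(τ)‖_{W^{1,∞}(cell)} dτ ≤ B`, one has
`‖u(t)‖_{H³(cell)} ≤ ‖u₀‖_{H³(cell)} · exp(C B)` (in `ℝ≥0∞`; (14) with the monotonicity of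
`exp`). Adaptation caveat (bounded domain of `ℝ³` → periodic cylinder, a compact flat manifold
with boundary) as in `Ferrari1993_periodicCylinderH3Bound`. [cite: Ferrari1993, (13)–(14) p. 281 with Lemmas 1–2 pp. 280–281]
[cite: ShirotaYanagisawa1993, (14) p. 80] [cite: LuoHou2014, §4.4 p. 1744 (use in the periodic cylinder)] -/
def Ferrari1993_periodicCylinderHsEnergyInequality : Prop :=
  ∀ (L : ℝ) (_hL : 0 < L), ∃ C : ℝ≥0, ∀ (u₀ : ℝ³ → ℝ³) (T : ℝ) (_hT : 0 < T) (u : ℝ → ℝ³ → ℝ³)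
    (p : ℝ → ℝ³ → ℝ) (_hsol : IsPeriodicCylinderEulerSolution L (Ico 0 T) u₀ u p) (t : ℝ)
    (_ht : t ∈ Ico (0 : ℝ) T) (B : ℝ≥0)
    (_hB : ∫⁻ τ in Ioo (0 : ℝ) t,
      FunctionSpaces.eSobolevDomainNorm 1 ∞ (cylinderCell L) volume (u τ) ≤ B),
    FunctionSpaces.eSobolevDomainNorm 3 2 (cylinderCell L) volume (u t) ≤
      FunctionSpaces.eSobolevDomainNorm 3 2 (cylinderCell L) volume u₀ *
        ENNReal.ofReal (Real.exp (C * B))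

/-- **The logarithmic `W^{1,∞}` estimate, general topology** (Shirota–Yanagisawa 1993, (15) and
(17), p. 80: for a smooth solution `u ∈ X_s(T)`, `s > 2`, of the Euler equations (1)–(2) in a
bounded domain `Ω ⊂ ℝ³` with smooth boundary,
`|∇u(t)|_{L^∞(Ω)} ≤ C{‖u(0)‖₀ + 1 + (1 + log⁺ ‖u(t)‖_s) |du(t)|_{L^∞(Ω)}}`, `|du| = |rot u|`,
the harmonic components `(u(t), aᵢ)` of the generalized Biot–Savart law (6) being bounded by the
energy `‖u(t)‖₀ ≤ ‖u(0)‖₀` (17); for `Ω` simply connected this is Ferrari 1993, (6) = (31),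
Cor. 1 of Prop. 1, p. 286: `|u(t)|_{W^{1,∞}} ≤ C[(1 + log⁺ |u(t)|_{H³}) |ω(t)|_{L^∞} + 1]`;
whole space: Beale–Kato–Majda 1984). **Rendering** (periodic class, `s = 3`; the periodic
cylinder is *not* simply connected — `e_z` is harmonic: `curl e_z = 0`, `div e_z = 0`,
`e_z · e_r = 0` — so the general-topology form with the energy of the datum is the one that
applies; the full `W^{1,∞}(cell)` norm of the tree, `‖u‖_{L^∞} + Σᵢ ‖∂ᵢu‖_{L^∞}`, is bounded,
`‖u‖_{L^∞}` being controlled by `‖∇u‖_{L^∞}` and `‖u‖_{L²} ≤ ‖u₀‖_{L²}` on the bounded cell;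
right-hand side monotone in the three sizes, which therefore enter as upper bounds): for `L > 0`
there is `C` such that for every solution `(u, p)` of the class on `[0, T)` with datum `u₀`,
every `t ∈ [0, T)` and all `n, e₀, A ≥ 0` with `‖u(t)‖_{H³(cell)} ≤ n`, `‖u₀‖_{L²(cell)} ≤ e₀`
and `|curl u(t, x)| ≤ A` on `{r < 1}`, one has
`‖u(t)‖_{W^{1,∞}(cell)} ≤ C (e₀ + 1 + (1 + log⁺ n) A)`. Adaptation caveat (bounded domain of
`ℝ³` → periodic cylinder) as in `Ferrari1993_periodicCylinderH3Bound`. [cite: ShirotaYanagisawa1993, (15) and (17) p. 80]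
[cite: Ferrari1993, (6) = (31), Cor. 1 of Prop. 1 (p. 286), simply connected case]
[cite: LuoHou2014, §4.4 p. 1744 (use in the periodic cylinder)] -/
def ShirotaYanagisawa1993_periodicCylinderLogEstimate : Prop :=
  ∀ (L : ℝ) (_hL : 0 < L), ∃ C : ℝ≥0, ∀ (u₀ : ℝ³ → ℝ³) (T : ℝ) (_hT : 0 < T) (u : ℝ → ℝ³ → ℝ³)
    (p : ℝ → ℝ³ → ℝ) (_hsol : IsPeriodicCylinderEulerSolution L (Ico 0 T) u₀ u p) (t : ℝ)
    (_ht : t ∈ Ico (0 : ℝ) T) (n e₀ A : ℝ≥0)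
    (_hn : FunctionSpaces.eSobolevDomainNorm 3 2 (cylinderCell L) volume (u t) ≤ n)
    (_he : FunctionSpaces.eSobolevDomainNorm 0 2 (cylinderCell L) volume u₀ ≤ e₀)
    (_hA : ∀ x ∈ (unitCylinder : Set ℝ³), ‖curl (u t) x‖ ≤ A),
    FunctionSpaces.eSobolevDomainNorm 1 ∞ (cylinderCell L) volume (u t) ≤
      ENNReal.ofReal (C * (e₀ + 1 + (1 + Real.posLog n) * A))

/-- **Time-local boundedness of the `H³` norms in the smooth class** (the solution class of
Ferrari's Thm 2 is `C([0,T]; H^s(Ω))`, p. 279, that of Shirota–Yanagisawa is `X_s(T')` for all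
`T' < T`, p. 77; a solution of the smooth periodic class, `C^∞` up to the boundary jointly in
`(t, x)` on `[0, T) × {r ≤ 1}`, has all classical derivatives bounded on `[0, b] × {r ≤ 1, 0 ≤ z ≤ L}`
for `b < T`, whence `sup_{t ∈ [0,b]} ‖u(t)‖_{H³(cell)} < ∞`). Recorded as a proposition because
the tree's `eSobolevDomainNorm` is defined through weak derivatives (the bound needs: classical
derivatives of a slice are weak derivatives on the cell); it is the regularity input of the
Gronwall step of `Ferrari1993_periodicCylinderH3Bound_of_estimates`. [folklore] -/
def smoothPeriodicCylinderClass_locallyBoundedH3Norm : Prop :=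
  ∀ (L : ℝ) (u₀ : ℝ³ → ℝ³) (T : ℝ) (u : ℝ → ℝ³ → ℝ³) (p : ℝ → ℝ³ → ℝ)
    (_hsol : IsPeriodicCylinderEulerSolution L (Ico 0 T) u₀ u p) (b : ℝ) (_hb : b < T),
    ∃ M : ℝ≥0, ∀ t ∈ Icc (0 : ℝ) b,
      FunctionSpaces.eSobolevDomainNorm 3 2 (cylinderCell L) volume (u t) ≤ M

/-! ### Gronwall's inequality by Picard iteration -/

/-- **Gronwall's lemma in integral form, without measurability, by Picard iteration.** Let
`f : ℝ → ℝ` be bounded above by `m` on `[0, b]` and suppose that every continuous majorant `g`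
of `f` on `[0, b]` feeds back into the affine-integral bound
`f(t) ≤ α + β t + γ ∫₀ᵗ g(τ) dτ` (`t ∈ [0, b]`, `α, β ≥ 0`). Then `f(t) ≤ (α + β b) e^{γ t}` on
`[0, b]`: the majorants `g_k(t) = (α + βb) e^{γt} + m (γt)^k / k!` improve under the feedback
(`γ ∫₀ᵗ e^{γτ} dτ = e^{γt} − 1`, `∫₀ᵗ τ^k dτ = t^{k+1}/(k+1)`), and `(γt)^k / k! → 0`. This is
the form in which the estimate (14) of Ferrari 1993 (integrated, with an unspecified
integrand regularity) can be combined with the pointwise estimate (31). [folklore] -/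
theorem gronwall_picard {f : ℝ → ℝ} {b α β γ m : ℝ} (hα : 0 ≤ α) (hβ : 0 ≤ β)
    (hm : ∀ t ∈ Icc (0 : ℝ) b, f t ≤ m)
    (H : ∀ g : ℝ → ℝ, ContinuousOn g (Icc 0 b) → (∀ t ∈ Icc (0 : ℝ) b, f t ≤ g t) →
      ∀ t ∈ Icc (0 : ℝ) b, f t ≤ α + β * t + γ * ∫ τ in (0 : ℝ)..t, g τ) :
    ∀ t ∈ Icc (0 : ℝ) b, f t ≤ (α + β * b) * Real.exp (γ * t) := by
  -- the Picard iterates bound `f`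
  have iter : ∀ k : ℕ, ∀ t ∈ Icc (0 : ℝ) b,
      f t ≤ (α + β * b) * Real.exp (γ * t) + m * (γ * t) ^ k / k ! := by
    intro k
    induction k with
    | zero =>
      intro t ht
      have hab : 0 ≤ (α + β * b) * Real.exp (γ * t) :=
        mul_nonneg (add_nonneg hα (mul_nonneg hβ (ht.1.trans ht.2))) (Real.exp_pos _).le
      have hft := hm t ht
      simp only [pow_zero, Nat.factorial_zero, Nat.cast_one, div_one, mul_one]
      linarith
    | succ k ih =>
      intro t ht
      set g : ℝ → ℝ := fun τ => (α + β * b) * Real.exp (γ * τ) + m * (γ * τ) ^ k / k ! with hg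
      have hgc : ContinuousOn g (Icc 0 b) := by
        apply Continuous.continuousOn
        simp only [hg]
        fun_prop
      have h1 := H g hgc ih t ht
      -- the two elementary integrals
      have hexp : ∫ τ in (0 : ℝ)..t, γ * Real.exp (γ * τ) = Real.exp (γ * t) - 1 := by
        have hderiv : ∀ x ∈ uIcc (0 : ℝ) t,
            HasDerivAt (fun τ => Real.exp (γ * τ)) (γ * Real.exp (γ * x)) x := by
          intro x _
          have h := ((hasDerivAt_id x).const_mul γ).exp
          simpa [mul_comm] using h
        rw [intervalIntegral.integral_eq_sub_of_hasDerivAt hderiv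
          (by apply Continuous.intervalIntegrable; fun_prop)]
        simp
      have hpow : ∫ τ in (0 : ℝ)..t, τ ^ k = t ^ (k + 1) / (k + 1) := by
        rw [integral_pow]
        simp
      have e1 : ∫ τ in (0 : ℝ)..t, g τ =
          ((α + β * b) * ∫ τ in (0 : ℝ)..t, Real.exp (γ * τ)) +
            (m * γ ^ k / k !) * ∫ τ in (0 : ℝ)..t, τ ^ k := by
        have hg' : g = fun τ => (α + β * b) * Real.exp (γ * τ) + (m * γ ^ k / k !) * τ ^ k := by
          funext τ
          simp only [hg, mul_pow]
          ring
        rw [hg', intervalIntegral.integral_add (by apply Continuous.intervalIntegrable; fun_prop)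
          (by apply Continuous.intervalIntegrable; fun_prop),
          intervalIntegral.integral_const_mul, intervalIntegral.integral_const_mul]
      have e2 : γ * ∫ τ in (0 : ℝ)..t, Real.exp (γ * τ) = Real.exp (γ * t) - 1 := by
        rw [← intervalIntegral.integral_const_mul, hexp]
      have hI : γ * ∫ τ in (0 : ℝ)..t, g τ =
          (α + β * b) * (Real.exp (γ * t) - 1) + m * (γ * t) ^ (k + 1) / (k + 1)! := by
        rw [e1, hpow, mul_add, ← mul_assoc γ (α + β * b), mul_comm γ (α + β * b),
          mul_assoc (α + β * b), e2, Nat.factorial_succ]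
        push_cast
        congr 1
        have hk : (k ! : ℝ) ≠ 0 := by positivity
        have hk1 : ((k : ℝ) + 1) ≠ 0 := by positivity
        field_simp
        ring
      have hβt : β * t ≤ β * b := mul_le_mul_of_nonneg_left ht.2 hβ
      calc f t ≤ α + β * t + γ * ∫ τ in (0 : ℝ)..t, g τ := h1
        _ = α + β * t + ((α + β * b) * (Real.exp (γ * t) - 1) +
              m * (γ * t) ^ (k + 1) / (k + 1)!) := by rw [hI]
        _ ≤ (α + β * b) * Real.exp (γ * t) + m * (γ * t) ^ (k + 1) / (k + 1)! := by
          nlinarith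
  -- let `k → ∞`
  intro t ht
  have hlim : Tendsto (fun k : ℕ => (α + β * b) * Real.exp (γ * t) + m * ((γ * t) ^ k / k !))
      atTop (𝓝 ((α + β * b) * Real.exp (γ * t) + m * 0)) :=
    tendsto_const_nhds.add
      (tendsto_const_nhds.mul (FloorSemiring.tendsto_pow_div_factorial_atTop (γ * t)))
  rw [mul_zero, add_zero] at hlim
  refine ge_of_tendsto' hlim fun k => ?_
  have h := iter k t ht
  rwa [mul_div_assoc] at h

/-! ### The target fact from the two estimates -/

/-- **`Ferrari1993_periodicCylinderH3Bound` from the `H^s` energy inequality, the logarithmic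
estimate and time-local boundedness** — the Gronwall argument (15)–(17) of Ferrari 1993,
pp. 281–282 (Shirota–Yanagisawa 1993, "combining (14)–(16) … in the same way as in [2]";
Beale–Kato–Majda 1984 in the whole space), run on `f(t) = log(‖u(t)‖_{H³(cell)} + 1)`: with `A`
a bound of the vorticity and `e₀ = M₀ ≥ ‖u₀‖_{L²(cell)}` (`M₀` the `H³` bound at time `0`), the
logarithmic estimate turns any continuous majorant `g ≥ f` on `[0, t]` into the bound
`‖u(τ)‖_{W^{1,∞}} ≤ C₂(e₀ + 1 + (1 + g(τ)) A)` (`log⁺ n ≤ log(n + 1)`), the energy inequality then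
gives `f(s) ≤ f(0) + C₁C₂(e₀ + 1 + A) s + C₁C₂A ∫₀ˢ g`, and `gronwall_picard` (with the local
bound on `[0, t]`) yields `f(t) ≤ (f(0) + βT) e^{γT}`, i.e. (17):
`‖u(t)‖_{H³(cell)} ≤ K = exp((log(‖u₀‖_{H³} + 1) + βT) e^{γT})` for all `t < T`. [cite: Ferrari1993, proof of Thm 2, (15)–(17) pp. 281–282] -/
theorem Ferrari1993_periodicCylinderH3Bound_of_estimates
    (hA : Ferrari1993_periodicCylinderHsEnergyInequality)
    (hB : ShirotaYanagisawa1993_periodicCylinderLogEstimate)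
    (hX : smoothPeriodicCylinderClass_locallyBoundedH3Norm) :
    Ferrari1993_periodicCylinderH3Bound := by
  intro L hL u₀ T hT u p hsol hbdd
  obtain ⟨C₁, hC₁⟩ := hA L hL
  obtain ⟨C₂, hC₂⟩ := hB L hL
  obtain ⟨A₀, hA₀⟩ := hbdd
  -- a nonnegative vorticity bound
  set A : ℝ≥0 := Real.toNNReal A₀ with hAdef
  have hAbd : ∀ t ∈ Ico (0 : ℝ) T, ∀ x ∈ (unitCylinder : Set ℝ³), ‖curl (u t) x‖ ≤ A :=
    fun t ht x hx => (hA₀ t ht x hx).trans (Real.le_coe_toNNReal A₀)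
  -- the `H³` norm as a function of time
  set N : ℝ → ℝ≥0∞ := fun t =>
    FunctionSpaces.eSobolevDomainNorm 3 2 (cylinderCell L) volume (u t) with hNdef
  -- finiteness at time `0`, and the energy of the datum
  obtain ⟨M₀, hM₀⟩ := hX L u₀ T u p hsol 0 hT
  have hN0 : N 0 ≤ M₀ := hM₀ 0 ⟨le_rfl, le_rfl⟩
  have he₀ : FunctionSpaces.eSobolevDomainNorm 0 2 (cylinderCell L) volume u₀ ≤ M₀ := by
    rw [← hsol.initial, FunctionSpaces.eSobolevDomainNorm_zero]
    exact (FunctionSpaces.eLpNorm_le_eSobolevDomainNorm (k := 3)).trans hN0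
  have hN0' : N 0 ≠ ⊤ := (hN0.trans_lt ENNReal.coe_lt_top).ne
  -- the constants of the final bound
  set n₀ : ℝ := (N 0).toReal with hn₀
  set α : ℝ := Real.log (n₀ + 1) with hα
  set β : ℝ := C₁ * (C₂ * (M₀ + 1 + A)) with hβ
  set γ : ℝ := C₁ * (C₂ * A) with hγ
  set K : ℝ := Real.exp ((α + β * T) * Real.exp (γ * T)) with hK
  have hα0 : 0 ≤ α := Real.log_nonneg (by linarith [ENNReal.toReal_nonneg (a := N 0)])
  have hβ0 : 0 ≤ β := by positivity
  have hγ0 : 0 ≤ γ := by positivity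
  refine ⟨Real.toNNReal K, fun t ht => ?_⟩
  -- local bound on `[0, t]`
  obtain ⟨M, hM⟩ := hX L u₀ T u p hsol t ht.2
  have hfin : ∀ τ ∈ Icc (0 : ℝ) t, N τ ≠ ⊤ := fun τ hτ => ((hM τ hτ).trans_lt ENNReal.coe_lt_top).ne
  -- the real function on which Gronwall is run
  set f : ℝ → ℝ := fun τ => Real.log ((N τ).toReal + 1) with hf
  have hf0 : ∀ τ, 0 ≤ f τ := fun τ =>
    Real.log_nonneg (by linarith [ENNReal.toReal_nonneg (a := N τ)])
  have hfm : ∀ τ ∈ Icc (0 : ℝ) t, f τ ≤ Real.log (M + 1) := by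
    intro τ hτ
    have h1 : (N τ).toReal ≤ M := ENNReal.toReal_le_coe_of_le_coe (hM τ hτ)
    exact Real.log_le_log (by linarith [ENNReal.toReal_nonneg (a := N τ)]) (by linarith)
  -- the feedback inequality
  have H : ∀ g : ℝ → ℝ, ContinuousOn g (Icc 0 t) → (∀ τ ∈ Icc (0 : ℝ) t, f τ ≤ g τ) →
      ∀ s ∈ Icc (0 : ℝ) t, f s ≤ α + β * s + γ * ∫ τ in (0 : ℝ)..s, g τ := by
    intro g hg hfg s hs
    have hst : Icc (0 : ℝ) s ⊆ Icc 0 t := Icc_subset_Icc_right hs.2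
    have hg0 : ∀ τ ∈ Icc (0 : ℝ) t, 0 ≤ g τ := fun τ hτ => (hf0 τ).trans (hfg τ hτ)
    -- the bound of the `W^{1,∞}` norm on `[0, s]` produced by the logarithmic estimate
    set h : ℝ → ℝ := fun τ => C₂ * (M₀ + 1 + (1 + g τ) * A) with hh
    have hhc : ContinuousOn h (Icc 0 s) := by
      have : ContinuousOn g (Icc 0 s) := hg.mono hst
      simp only [hh]
      fun_prop
    have hh0 : ∀ τ ∈ Icc (0 : ℝ) s, 0 ≤ h τ := by
      intro τ hτ
      have := hg0 τ (hst hτ)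
      simp only [hh]
      positivity
    have hW : ∀ τ ∈ Ioo (0 : ℝ) s,
        FunctionSpaces.eSobolevDomainNorm 1 ∞ (cylinderCell L) volume (u τ) ≤
          ENNReal.ofReal (h τ) := by
      intro τ hτ
      have hτt : τ ∈ Icc (0 : ℝ) t := hst ⟨hτ.1.le, hτ.2.le⟩
      have hτT : τ ∈ Ico (0 : ℝ) T := ⟨hτ.1.le, hτt.2.trans_lt ht.2⟩
      have hNτ : N τ ≤ ((N τ).toNNReal : ℝ≥0∞) := (ENNReal.coe_toNNReal (hfin τ hτt)).ge
      refine (hC₂ u₀ T hT u p hsol τ hτT (N τ).toNNReal M₀ A hNτ he₀ (hAbd τ hτT)).trans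
        (ENNReal.ofReal_le_ofReal ?_)
      have hlog : Real.posLog ((N τ).toNNReal : ℝ) ≤ g τ := by
        refine le_trans ?_ (hfg τ hτt)
        simp only [hf, ENNReal.coe_toNNReal_eq_toReal]
        rw [Real.posLog_eq_log_max_one ENNReal.toReal_nonneg]
        exact Real.log_le_log (by positivity)
          (max_le (by linarith [ENNReal.toReal_nonneg (a := N τ)]) (by linarith))
      simp only [hh]
      gcongr
    -- its time integral bounds the lower integral of the `W^{1,∞}` norm
    have hint : IntegrableOn h (Icc 0 s) volume := hhc.integrableOn_Icc
    have hI : ∫⁻ τ in Ioo (0 : ℝ) s,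
        FunctionSpaces.eSobolevDomainNorm 1 ∞ (cylinderCell L) volume (u τ) ≤
          ENNReal.ofReal (∫ τ in (0 : ℝ)..s, h τ) := by
      calc ∫⁻ τ in Ioo (0 : ℝ) s, FunctionSpaces.eSobolevDomainNorm 1 ∞ (cylinderCell L) volume (u τ)
          ≤ ∫⁻ τ in Ioo (0 : ℝ) s, ENNReal.ofReal (h τ) := setLIntegral_mono' measurableSet_Ioo hW
        _ = ENNReal.ofReal (∫ τ in Ioo (0 : ℝ) s, h τ) := by
          rw [ofReal_integral_eq_lintegral_ofReal (hint.mono_set Ioo_subset_Icc_self)]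
          exact (ae_restrict_iff' measurableSet_Ioo).2 (Eventually.of_forall fun τ hτ =>
            hh0 τ ⟨hτ.1.le, hτ.2.le⟩)
        _ = ENNReal.ofReal (∫ τ in (0 : ℝ)..s, h τ) := by
          rw [intervalIntegral.integral_of_le hs.1, integral_Ioc_eq_integral_Ioo]
    have hIs0 : 0 ≤ ∫ τ in (0 : ℝ)..s, h τ :=
      intervalIntegral.integral_nonneg hs.1 fun τ hτ => hh0 τ hτ
    set B : ℝ≥0 := Real.toNNReal (∫ τ in (0 : ℝ)..s, h τ) with hBdef
    have hB : ∫⁻ τ in Ioo (0 : ℝ) s,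
        FunctionSpaces.eSobolevDomainNorm 1 ∞ (cylinderCell L) volume (u τ) ≤ B := by
      simpa only [hBdef, ENNReal.ofReal] using hI
    -- the energy inequality from time `0` to time `s`
    have hsT : s ∈ Ico (0 : ℝ) T := ⟨hs.1, hs.2.trans_lt ht.2⟩
    have hNs := hC₁ u₀ T hT u p hsol s hsT B hB
    rw [← hsol.initial] at hNs
    have hNs' : (N s).toReal ≤ n₀ * Real.exp (C₁ * B) := by
      have h1 := ENNReal.toReal_mono (ENNReal.mul_ne_top hN0' ENNReal.ofReal_ne_top) hNs
      rwa [ENNReal.toReal_mul, ENNReal.toReal_ofReal (Real.exp_pos _).le] at h1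
    have hB' : (C₁ : ℝ) * B = β * s + γ * ∫ τ in (0 : ℝ)..s, g τ := by
      have hBval : ((B : ℝ≥0) : ℝ) = ∫ τ in (0 : ℝ)..s, h τ := Real.coe_toNNReal _ hIs0
      have hgi : IntervalIntegrable g volume 0 s :=
        (hg.mono (by rwa [uIcc_of_le hs.1])).intervalIntegrable
      have hsplit : ∫ τ in (0 : ℝ)..s, h τ =
          C₂ * (M₀ + 1 + A) * s + C₂ * A * ∫ τ in (0 : ℝ)..s, g τ := by
        have hh' : h = fun τ => C₂ * (M₀ + 1 + A) + (C₂ * A) * g τ := by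
          funext τ
          simp only [hh]
          ring
        rw [hh', intervalIntegral.integral_add intervalIntegrable_const (hgi.const_mul _),
          intervalIntegral.integral_const, intervalIntegral.integral_const_mul]
        simp only [sub_zero, smul_eq_mul]
        ring
      rw [hBval, hsplit, hβ, hγ]
      ring
    -- take logarithms
    have hn₀0 : 0 ≤ n₀ := ENNReal.toReal_nonneg
    have hexp1 : 1 ≤ Real.exp (C₁ * B) := Real.one_le_exp (by positivity)
    calc f s = Real.log ((N s).toReal + 1) := rfl
      _ ≤ Real.log ((n₀ + 1) * Real.exp (C₁ * B)) := by
        refine Real.log_le_log (by linarith [ENNReal.toReal_nonneg (a := N s)]) ?_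
        nlinarith
      _ = α + C₁ * B := by
        rw [Real.log_mul (by linarith) (Real.exp_pos _).ne', Real.log_exp]
      _ = α + β * s + γ * ∫ τ in (0 : ℝ)..s, g τ := by rw [hB', add_assoc]
  -- Gronwall
  have key := gronwall_picard hα0 hβ0 hfm H t ⟨ht.1, le_rfl⟩
  -- unwind: `f t ≤ (α + β T) e^{γ T}`, so `‖u(t)‖_{H³} + 1 ≤ K`
  have hft : f t ≤ (α + β * T) * Real.exp (γ * T) := by
    refine key.trans ?_
    gcongr
    · exact ht.2.le
    · exact ht.2.le
  have hNt : (N t).toReal + 1 ≤ K := by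
    have hpos : 0 < (N t).toReal + 1 := by linarith [ENNReal.toReal_nonneg (a := N t)]
    rw [hK, ← Real.log_le_iff_le_exp hpos]
    exact hft
  have hNt' : (N t).toReal ≤ K := by linarith
  calc N t = ENNReal.ofReal (N t).toReal := (ENNReal.ofReal_toReal (hfin t ⟨ht.1, le_rfl⟩)).symm
    _ ≤ ENNReal.ofReal K := ENNReal.ofReal_le_ofReal hNt'
    _ = (Real.toNNReal K : ℝ≥0∞) := rfl

end Literature.Analysis.FluidPDE
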